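import Mathlib

/-!
# Stub `stub_capEasyRegime`

Line `singlet-fraction-transfer` of the crux `FidelityWitnesses.SevenEighthsLaw`.

Write `P2 = Fin 2 × Fin 2`. For `f : P2 → P2 → ℂ` the *multiplied vector* `m(f) : P2 → ℂ` is
`a ↦ Σ_μ f (a.1, μ) (μ, a.2)` (the matrix product `U V` when `f b c = U b * V c`). For a `k`-frame
`e` orthonormal for `⟨f, g⟩ = Σ_b Σ_c conj (f b c) * g b c`, the *capture* is
`cap e = Σ_s ‖m(e_s)‖²`.

`stub_capEasyRegime`: if the vectors `m(e_s)` span a subspace of `ℂ^{P2}` of dimension `≤ 3`, then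
`cap e ≤ 6` (indeed `≤ 2 · dim`).

Proof. Choose an orthonormal basis `q_1, …, q_r` (`r ≤ 3`) of `M = span {m(e_s)}` inside
`EuclideanSpace ℂ P2` (`stdOrthonormalBasis`). Parseval inside `M` gives
`‖m(e_s)‖² = Σ_j |⟨q_j, m(e_s)⟩|²`. The adjoint identity `⟨q, m(f)⟩ = ⟨m* q, f⟩` with
`(m* q) b c = [b.2 = c.1] · q (b.1, c.2)` and `‖m* q‖² = 2 ‖q‖²`, together with Bessel's inequality
for the orthonormal family `e` transported to `EuclideanSpace ℂ (P2 × P2)`, gives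
`Σ_s |⟨m* q_j, e_s⟩|² ≤ 2`; summing over `j ≤ r ≤ 3` yields `cap e ≤ 2 r ≤ 6`.
-/

set_option linter.dupNamespace false

namespace Summit.MatrixMultiplication.MatrixMultiplication.Theorems.SevenEighthsLaw

open scoped BigOperators ComplexConjugate InnerProductSpace

/-- Bessel's inequality in coordinates: if `e` is orthonormal for
`⟨f, g⟩ = Σ_b Σ_c conj (f b c) * g b c`, then `Σ_s |⟨g, e_s⟩|² ≤ Σ_b Σ_c |g b c|²` for every `g`.
-/
theorem stub_capEasyRegime_bessel {k : ℕ} (e : Fin k → (Fin 2 × Fin 2) → (Fin 2 × Fin 2) → ℂ)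
    (he : ∀ s t : Fin k, (∑ b, ∑ c, conj (e s b c) * e t b c) = if s = t then 1 else 0)
    (g : (Fin 2 × Fin 2) → (Fin 2 × Fin 2) → ℂ) :
    ∑ s, ‖∑ b, ∑ c, conj (g b c) * e s b c‖ ^ 2 ≤ ∑ b, ∑ c, ‖g b c‖ ^ 2 := by
  classical
  let E : Fin k → EuclideanSpace ℂ ((Fin 2 × Fin 2) × (Fin 2 × Fin 2)) :=
    fun s => WithLp.toLp 2 (fun bc => e s bc.1 bc.2)
  let G : EuclideanSpace ℂ ((Fin 2 × Fin 2) × (Fin 2 × Fin 2)) :=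
    WithLp.toLp 2 (fun bc => g bc.1 bc.2)
  have hE : Orthonormal ℂ E := by
    rw [orthonormal_iff_ite]
    intro s t
    rw [← he s t]
    simp only [E, PiLp.inner_apply, RCLike.inner_apply', Fintype.sum_prod_type]
  have hB := hE.sum_inner_products_le G (s := Finset.univ)
  have hG : ‖G‖ ^ 2 = ∑ b, ∑ c, ‖g b c‖ ^ 2 := by
    rw [EuclideanSpace.norm_sq_eq]
    simp only [G, Fintype.sum_prod_type]
  have hI : ∀ s, ⟪G, E s⟫_ℂ = ∑ b, ∑ c, conj (g b c) * e s b c := by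
    intro s
    simp only [E, G, PiLp.inner_apply, RCLike.inner_apply', Fintype.sum_prod_type]
  calc ∑ s, ‖∑ b, ∑ c, conj (g b c) * e s b c‖ ^ 2 = ∑ s, ‖⟪E s, G⟫_ℂ‖ ^ 2 := by
        refine Finset.sum_congr rfl fun s _ => ?_
        rw [norm_inner_symm, hI s]
    _ ≤ ‖G‖ ^ 2 := hB
    _ = ∑ b, ∑ c, ‖g b c‖ ^ 2 := hG

/-- The adjoint of the multiplication map `m(f) a = Σ_μ f (a.1, μ) (μ, a.2)` for the coordinate
inner products: `⟨q, m(f)⟩ = ⟨m* q, f⟩` with `(m* q) b c = [b.2 = c.1] · q (b.1, c.2)`. -/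
theorem stub_capEasyRegime_adjoint (q : (Fin 2 × Fin 2) → ℂ)
    (f : (Fin 2 × Fin 2) → (Fin 2 × Fin 2) → ℂ) :
    (∑ a : Fin 2 × Fin 2, conj (q a) * ∑ μ : Fin 2, f (a.1, μ) (μ, a.2)) =
      ∑ b : Fin 2 × Fin 2, ∑ c : Fin 2 × Fin 2,
        conj (if b.2 = c.1 then q (b.1, c.2) else 0) * f b c := by
  simp only [Fintype.sum_prod_type, Fin.sum_univ_two, Fin.isValue]
  simp only [Fin.isValue, ↓reduceIte, zero_ne_one, map_zero, zero_mul, add_zero, one_ne_zero,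
    zero_add]
  ring

/-- `‖m* q‖² = 2 ‖q‖²`: every value `q a` occurs exactly twice in `m* q`. -/
theorem stub_capEasyRegime_adjoint_norm (q : (Fin 2 × Fin 2) → ℂ) :
    (∑ b : Fin 2 × Fin 2, ∑ c : Fin 2 × Fin 2, ‖(if b.2 = c.1 then q (b.1, c.2) else 0 : ℂ)‖ ^ 2) =
      2 * ∑ a : Fin 2 × Fin 2, ‖q a‖ ^ 2 := by
  simp only [Fintype.sum_prod_type, Fin.sum_univ_two, Fin.isValue]
  simp only [↓reduceIte, Fin.isValue, zero_ne_one, norm_zero, ne_eq, OfNat.ofNat_ne_zero,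
    not_false_eq_true, zero_pow, add_zero, one_ne_zero, zero_add]
  ring

/-- **Stub 3 — the EASY regime.** If the multiplied vectors `m(e_s) : a ↦ Σ_μ e_s (a.1,μ) (μ,a.2)`
of an orthonormal `k`-frame `e` span at most `3` dimensions of `ℂ^{P2}`, then `cap e ≤ 6`. -/
theorem stub_capEasyRegime {k : ℕ} (e : Fin k → (Fin 2 × Fin 2) → (Fin 2 × Fin 2) → ℂ)
    (he : ∀ s t : Fin k, (∑ b, ∑ c, conj (e s b c) * e t b c) = if s = t then 1 else 0)
    (hdim : Module.finrank ℂ (Submodule.span ℂ (Set.range fun s : Fin k =>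
        fun a : Fin 2 × Fin 2 => ∑ μ : Fin 2, e s (a.1, μ) (μ, a.2))) ≤ 3) :
    ∑ s, ∑ a : Fin 2 × Fin 2, ‖∑ m : Fin 2, e s (a.1, m) (m, a.2)‖ ^ 2 ≤ 6 := by
  classical
  -- the multiplied vectors, as plain functions and inside `EuclideanSpace ℂ P2`
  set v0 : Fin k → (Fin 2 × Fin 2) → ℂ := fun s a => ∑ μ : Fin 2, e s (a.1, μ) (μ, a.2) with hv0
  let M0 : Submodule ℂ ((Fin 2 × Fin 2) → ℂ) := Submodule.span ℂ (Set.range v0)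
  let L : ((Fin 2 × Fin 2) → ℂ) →ₗ[ℂ] EuclideanSpace ℂ (Fin 2 × Fin 2) :=
    (WithLp.linearEquiv 2 ℂ ((Fin 2 × Fin 2) → ℂ)).symm.toLinearMap
  let v : Fin k → EuclideanSpace ℂ (Fin 2 × Fin 2) := fun s => L (v0 s)
  let M : Submodule ℂ (EuclideanSpace ℂ (Fin 2 × Fin 2)) := M0.map L
  have hvM : ∀ s, v s ∈ M := fun s => Submodule.mem_map_of_mem (Submodule.subset_span ⟨s, rfl⟩)
  have hr : Module.finrank ℂ M ≤ 3 := (Submodule.finrank_map_le L M0).trans hdim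
  -- an orthonormal basis of `M`
  let b := stdOrthonormalBasis ℂ M
  -- Parseval inside `M`
  have hpars : ∀ s, (∑ a : Fin 2 × Fin 2, ‖∑ m : Fin 2, e s (a.1, m) (m, a.2)‖ ^ 2)
      = ∑ j, ‖⟪(b j : EuclideanSpace ℂ (Fin 2 × Fin 2)), v s⟫_ℂ‖ ^ 2 := by
    intro s
    have h1 := b.sum_sq_norm_inner_right ⟨v s, hvM s⟩
    simp only [Submodule.coe_inner, Submodule.coe_norm] at h1
    rw [h1, EuclideanSpace.norm_sq_eq]
    rfl
  -- the bound for one unit vector `q` of `M`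
  have hq : ∀ j, ∑ s, ‖⟪(b j : EuclideanSpace ℂ (Fin 2 × Fin 2)), v s⟫_ℂ‖ ^ 2 ≤ 2 := by
    intro j
    set q : EuclideanSpace ℂ (Fin 2 × Fin 2) := (b j : EuclideanSpace ℂ (Fin 2 × Fin 2)) with hqdef
    have hq1 : ‖q‖ = 1 := by
      rw [hqdef, ← Submodule.coe_norm]
      exact b.orthonormal.norm_eq_one j
    have hinner : ∀ s, ⟪q, v s⟫_ℂ = ∑ b' : Fin 2 × Fin 2, ∑ c : Fin 2 × Fin 2,
        conj (if b'.2 = c.1 then q (b'.1, c.2) else 0) * e s b' c := by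
      intro s
      rw [← stub_capEasyRegime_adjoint]
      simp only [PiLp.inner_apply, RCLike.inner_apply']
      rfl
    calc ∑ s, ‖⟪q, v s⟫_ℂ‖ ^ 2
        = ∑ s, ‖∑ b' : Fin 2 × Fin 2, ∑ c : Fin 2 × Fin 2,
            conj (if b'.2 = c.1 then q (b'.1, c.2) else 0) * e s b' c‖ ^ 2 := by
          simp_rw [hinner]
      _ ≤ ∑ b' : Fin 2 × Fin 2, ∑ c : Fin 2 × Fin 2,
            ‖(if b'.2 = c.1 then q (b'.1, c.2) else 0 : ℂ)‖ ^ 2 :=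
          stub_capEasyRegime_bessel e he _
      _ = 2 * ∑ a : Fin 2 × Fin 2, ‖q a‖ ^ 2 := stub_capEasyRegime_adjoint_norm _
      _ = 2 * ‖q‖ ^ 2 := by rw [EuclideanSpace.norm_sq_eq]
      _ = 2 := by rw [hq1]; norm_num
  -- summing up
  calc ∑ s, ∑ a : Fin 2 × Fin 2, ‖∑ m : Fin 2, e s (a.1, m) (m, a.2)‖ ^ 2
      = ∑ s, ∑ j, ‖⟪(b j : EuclideanSpace ℂ (Fin 2 × Fin 2)), v s⟫_ℂ‖ ^ 2 :=
        Finset.sum_congr rfl fun s _ => hpars s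
    _ = ∑ j, ∑ s, ‖⟪(b j : EuclideanSpace ℂ (Fin 2 × Fin 2)), v s⟫_ℂ‖ ^ 2 := Finset.sum_comm
    _ ≤ ∑ _j : Fin (Module.finrank ℂ M), (2 : ℝ) := Finset.sum_le_sum fun j _ => hq j
    _ = 2 * (Module.finrank ℂ M : ℝ) := by simp [mul_comm]
    _ ≤ 6 := by
        have h3 : (Module.finrank ℂ M : ℝ) ≤ 3 := by exact_mod_cast hr
        linarith

end Summit.MatrixMultiplication.MatrixMultiplication.Theorems.SevenEighthsLaw
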